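import Literature.InformationTheory.QuantumCodes.ConnectivitySeparatorBalance
import HarnessLib

/-!
# Rate–distance trade-off for quantum codes with polynomially separable connectivity graphs
# (Baspin–Guruswami–Krishna–Li, Theorem «thm:main»: `k·d^{(1−c²)/c} = O(n)`) — PROVED

N. Baspin, V. Guruswami, A. Krishna, R. Li, *Improved rate-distance trade-offs for quantum codes with
restricted connectivity*, Quantum Sci. Technol. 10 (2025) 015021 = arXiv:2307.03283 [BaspinEtAl2024]
(held text `paper:arxiv-2307.03283`), §3.2, read on the page:

> «Theorem (Theorem (thm:main), formal). Let β ≥ 1 and c ∈ (0,1) be constants. There exists a constant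
> α = α(β,c) > 0 such that the following holds for all positive integers n, k, d. Let 𝒬 be a ⟦n,k,d⟧
> quantum code with connectivity graph G. If the separation profile of G satisfies s_G(r) ≤ βr^c for
> c ∈ (0,1], then we have the following trade-off between k and d: k·d^{(1−c²)/c} ≤ αn.»
> (chunk p0007 L98 – p0008 L1)
> «Lemma 3.4. … there exists a partition A ⊔ B ⊔ C of G such that A and B are d-correctable and
> |C| ≤ α·n/d^{(1−c)(1+1/c)}.» (chunk p0008 L3–8)
> «Lemma 3.6. Let β ≥ 1 and c ∈ (0,1) be constants. There exists a constant α = α(β,c) > 0 such that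
> the following holds for all positive integers n ≥ d. Let G be a graph on n vertices where s_G(r) ≤ βr^c
> for all r. There exists a d-correctable set A such that |V∖A| ≤ (αn)/(d^{(1−c)/c}).» (chunk p0009 L1–5)
> Proof of Lemma 3.6 (chunk p0009 L6–34): «By Lemma 2.10 [= Henzinger–Klein–Rao–Subramanian 1997,
> Lemma 2.1: an r-division W₁',…,W_ℓ', |Wᵢ'| ≤ r, |∂₋Wᵢ'| ≤ α·s_G(r), ℓ ≤ αn/r] with r ≔ (εd)^{1/c} …
> let Wᵢ ≔ Wᵢ' ∖ ∂₋Wᵢ'. Note that the outer boundary ∂₊Wᵢ is contained in ∂₋Wᵢ' … we can apply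
> Lemma 3.5 which implies that Wᵢ is correctable … Wᵢ is disconnected from Wⱼ for all i ≠ j. Therefore,
> by the Union Lemma, A is correctable. … |V∖A| = |⋃ᵢ ∂₋Wᵢ'| ≤ α·n/(εd)^{1/c} · d/4.»
> Proof of Lemma 3.4 (chunk p0009 L50–68): Lemma 3.6, then «Apply Lemma 3.3 [= Baspin–Krishna's
> recursive separation into decoupled blocks of size < d] to the subgraph G[V∖A] … |C| ≤ α·n/d^{(1−c)+(1−c)/c}»,
> and Theorem «thm:main» follows «by Lemma 2.2 [k ≤ |C|, Bravyi–Poulin–Terhal] and Corollary 2.7».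

What this file proves (KERNEL, no named fact), for stabilizer codes `S̄ = ⟨g⟩` presented by a generator
family `g` whose connectivity graph is `(s, p/q)`-separable (`IsSeparableWith`, the printed `2/3`-balanced
separation profile being `p/q = 2/3`) with `s(m) ≤ C·m^c`, in the vocabulary of
`ConnectivityDimensionBound.lean` / `ConnectivityDistanceBound.lean` / `ConnectivitySeparatorBalance.lean`:
* `exists_correctable_interior_of_potential` — the combinatorial core: a recursion over REGIONS
  (interior `I`, boundary `D ⊇ ∂₊I`) split with duplicated separators, by cardinality while large and by
  boundary cost while the boundary is large, leaves certified by Lemma 3.5 (`BaspinEtAl2024_lemma35_inv`),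
  children glued by the Union Lemma; any potential paying for the separators bounds the loss;
* `exists_division_potential` — an explicit such potential (Frederickson's two-phase accounting as one
  function `a·m·ρ^{c−1} − b·g(m) + max(i − 4C₁ρ^c, 0)`);
* **`BaspinEtAl2024_lemma36_radius`** — Lemma 3.6 with an explicit radius `ρ`: a correctable `U` with
  `|V ∖ U| ≤ a·n·ρ^{c−1}`, `a = 8C₁/(2^{1−c} − 1)`, `C₁ = C/(1 − (p/q)^c)`, whenever `a·ρ^{c−1} ≤ 1` and
  `(6C₁ + C₁/(1 − 2^{−c}))·ρ^c < d/2`; **`BaspinEtAl2024_lemma34_radius`** — the dimension bound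
  `k ≤ M·a·n·ρ^{c−1}·d^{c−1}` (Lemma 3.4's `|C|` with `k ≤ |C|`); `exists_division_radius` — the printed
  choice `ρ = (δd)^{1/c}`;
* **`BaspinEtAl2024_lemma36`**, **`BaspinEtAl2024_theorem_main`** — the printed forms: a constant
  `α = α(C, c, p/q) > 0` such that for EVERY such code `|V ∖ A| ≤ αn/d^{(1−c)/c}` for some correctable `A`
  (`d ≥ 1`), resp. `k·d^{(1−c²)/c} ≤ αn` (all `n, k, d`; `c ∈ (0,1]`).

ROUTE DIFFERS FROM PRINT; STATEMENT AS PRINTED (qec-lead ruling, block 166 (2)). The deviation is one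
step of the proof: the paper imports the r-division Lemma 2.10 from
M. R. Henzinger, P. Klein, S. Rao, S. Subramanian, J. Comput. System Sci. 55 (1997) 3–23, Lemma 2.1 (a
Frederickson-type construction; that source is not held). Lemma 3.6 only uses, per piece, «size ≤ r and
boundary ≤ d/4» and, in total, «Σ boundaries ≤ αn·r^{c−1}»; the piece count `ℓ ≤ αn/r` is not used. This
file obtains exactly that by one strong induction (`exists_correctable_interior_of_potential`): the two
kinds of splits of G. N. Frederickson, SIAM J. Comput. 16 (1987) 1004–1022 (Lemma 1: recursive separation
with the separator copied into both halves; Lemma 2: re-splitting regions with many boundary vertices by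
separators balanced with respect to the boundary — here Lipton–Tarjan's Corollary 3 with costs, the tree's
`IsSeparableWith.exists_costHalves`) are interleaved and paid for by one explicit potential, so no region
count is needed and the leaves are handed directly to Lemma 3.5 and the Union Lemma as in the printed proof
of Lemma 3.6. Everything else (Lemma 3.5, the Baspin–Krishna recursion = Lemma 3.3, `k ≤ |C|`) is the
tree's, reused by name.

FAITHFULNESS / SCOPE: (a) «d-correctable with respect to G» (Definition 2.6, graph-theoretic) is replaced
by correctability for the given stabilizer code, into which it translates by the paper's Corollary 2.7 —
the code-level form is what Theorem «thm:main» uses; (b) separability is the tree's `IsSeparableWith g p q s`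
(every vertex set `W` has a `p/q`-balanced separation with separator `≤ s(|W|)`; a separation profile
`s_G(r) ≤ βr^c` gives this with `s = ` that bound, see `ConnectivitySeparatorBalance.lean`); `β ≥ 1` is not
needed, `C < 0` is vacuous; (c) the constants `α` are explicit in the `_radius` theorems and existentially
packaged (depending on `C, c, p/q` only — the quantifier order of the printed theorem) in the printed forms;
they are far from optimal; (d) stabilizer (additive) codes only, as everywhere in this part of the tree (the
paper's §2 framework is stated for general codes via Bravyi–Poulin–Terhal); no LDPC / degree hypothesis;
(e) NOT typed: Remark 3.7, §4 Conjectures 4.1/4.2 (conjectures are not literature).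

HONEST FRAMING (LADDER-QEC X1): a BARRIER theorem — sub-linearly separable connectivity (`s(r) = O(r^c)`,
`c < 1`) forces `k·d^{(1−c²)/c} = O(n)`, strictly stronger than Baspin–Krishna's `k·d^{2(1−c)} = O(n)`
(`ConnectivityDimensionBound.lean`) for every `c < 1`, and weaker than the conjectured `k·d^{2(1−c)/c}`. A
2023/2025 theorem formalized; no novelty (the potential bookkeeping replacing the cited r-division is a
routine variant of Frederickson's 1987 accounting).

## References
* [BaspinEtAl2024] §2.1 (∂₊, ∂₋; chunk p0005 L21–27), Lemma 2.3, §2.3 Defs 2.8–2.10 (chunk p0006 L28–63),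
  §3.2 Lemmas 3.4–3.6, Theorem «thm:main» formal, Remark 3.7 (chunks p0008–p0009).
* [BaspinKrishna2022] N. Baspin, A. Krishna, Quantum 6 (2022) 711, Lemma 21 (the tree's
  `BaspinKrishna2022_lemma21`, `sepSum_le_linear`).
* [LiptonTarjan1979] R. J. Lipton, R. E. Tarjan, SIAM J. Appl. Math. 36 (1979) 177–189, Corollary 3 (the
  tree's `IsSeparableWith.exists_costHalves`).
* [BravyiPoulinTerhal2010] `k ≤ |C|`, Union Lemma (the tree's `le_card_compl_of_isCorrectable`,
  `IsCorrectableRegion.union`).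
* G. N. Frederickson, *Fast algorithms for shortest paths in planar graphs, with applications*, SIAM J.
  Comput. 16 (1987) 1004–1022, Lemmas 1–2 (method only; not held — described after C. Wulff-Nilsen,
  arXiv:1008.1048 §3.1 and Lemma 4, held `paper:arxiv-1008.1048` chunks p0005–p0007).

## Mathlib / tree search
`rg -i 'r-division|Frederickson|Henzinger' Literature/InformationTheory/QuantumCodes Literature/Combinatorics`
(2026-08-27): only the two «not typed» notes of `ConnectivityDistanceBound.lean` / `ConnectivitySeparatorBalance.lean`
that this file discharges; `Literature/Combinatorics/SimpleGraph/*Separator*` concern Menger-type / chordal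
minimal separators (another notion); Mathlib has no separator-theorem / r-division material. Reused:
`CoversOuterBoundary`, `BaspinEtAl2024_lemma35_inv`, `coversOuterBoundary_univ`, `IsHalfSeparable`,
`IsSeparableWith(.mono/.isHalfSeparable/.exists_costHalves)`, `divSum(_mono/_le_linear)`,
`exists_monotone_ge_le_rpow`, `BaspinKrishna2022_lemma21`, `IsBlockLabelling.isCorrectableRegion`,
`sepSum_le_linear`, `le_card_compl_of_isCorrectable`, `IsCorrectableRegion(.union/.of_card_lt)`; Mathlib
`Real.rpow`, `Finset`.
-/

namespace Literature.InformationTheory.QuantumCodes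

open Finset

universe u

variable {n : ℕ} {G : Type*} (g : G → SympVec n)

/-! ### Regions with duplicated separators: one split -/

/-- **One split of a region with duplicated separator.** A region is a pair (interior `I`, boundary
`D`), disjoint, with `D ⊇ ∂₊I`. Separating `I ∪ D = A ⊔ C ⊔ B` (no generator meets both `A` and `B`;
`C` the separator) gives the child region with interior `I ∩ A` and boundary `(D ∩ A) ∪ C`: it is again
a region (`(D ∩ A) ∪ C ⊇ ∂₊(I ∩ A)`), and `|(D ∩ A) ∪ C| = |D ∩ A| + |C|`, `|I ∩ A| + |D ∩ A| = |A|`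
(the separator is copied into both children, the old boundary is shared out).
[cite: BaspinEtAl2024, §3.2 Lemma 3.6, proof («∂₊Wᵢ is contained in ∂₋Wᵢ'»; arXiv:2307.03283 chunk p0009 L17–21)] -/
theorem CoversOuterBoundary.split_child {I D A B : Finset (Fin n)} (hID : Disjoint I D)
    (hcov : CoversOuterBoundary g I D) (hA : A ⊆ I ∪ D) (hdec : Decoupled g A B) :
    Disjoint (I ∩ A) ((D ∩ A) ∪ (I ∪ D) \ (A ∪ B)) ∧
      CoversOuterBoundary g (I ∩ A) ((D ∩ A) ∪ (I ∪ D) \ (A ∪ B)) ∧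
      #((D ∩ A) ∪ (I ∪ D) \ (A ∪ B)) = #(D ∩ A) + #((I ∪ D) \ (A ∪ B)) ∧
      #(I ∩ A) + #(D ∩ A) = #A := by
  refine ⟨?_, ?_, ?_, ?_⟩
  · rw [disjoint_union_right]
    refine ⟨hID.mono inter_subset_left inter_subset_left, disjoint_left.2 fun x hx hx' => ?_⟩
    simp only [mem_sdiff, mem_union, not_or] at hx'
    exact hx'.2.1 (mem_inter.1 hx).2
  · intro a q hq q' hq' hqIA hq'IA
    rw [mem_inter] at hqIA
    have hq'B : q' ∉ B := hdec a q hq q' hq' hqIA.2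
    by_cases hq'I : q' ∈ I
    · have hq'A : q' ∉ A := fun h => hq'IA (mem_inter.2 ⟨hq'I, h⟩)
      refine mem_union_right _ (mem_sdiff.2 ⟨mem_union_left _ hq'I, ?_⟩)
      rw [mem_union, not_or]
      exact ⟨hq'A, hq'B⟩
    · have hq'D : q' ∈ D := hcov a q hq q' hq' hqIA.1 hq'I
      by_cases hq'A : q' ∈ A
      · exact mem_union_left _ (mem_inter.2 ⟨hq'D, hq'A⟩)
      · refine mem_union_right _ (mem_sdiff.2 ⟨mem_union_right _ hq'D, ?_⟩)
        rw [mem_union, not_or]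
        exact ⟨hq'A, hq'B⟩
  · refine card_union_of_disjoint (disjoint_left.2 fun x hx hx' => ?_)
    simp only [mem_sdiff, mem_union, not_or] at hx'
    exact hx'.2.1 (mem_inter.1 hx).2
  · rw [← card_union_of_disjoint (hID.mono inter_subset_left inter_subset_left)]
    congr 1
    ext x
    simp only [mem_union, mem_inter]
    constructor
    · rintro (⟨-, h⟩ | ⟨-, h⟩) <;> exact h
    · intro hxA
      rcases mem_union.1 (hA hxA) with h | h
      · exact Or.inl ⟨h, hxA⟩
      · exact Or.inr ⟨h, hxA⟩

/-- The vertices of the interior lost at a split: the separator, plus what is lost inside the two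
children. [cite: BaspinEtAl2024, §3.2 Lemma 3.6, proof («|V ∖ A| = |⋃ᵢ ∂₋Wᵢ'|»; chunk p0009 L31–34)] -/
theorem card_interior_sdiff_union_le (I D A B U₁ U₂ : Finset (Fin n)) :
    #(I \ (U₁ ∪ U₂)) ≤ #((I ∪ D) \ (A ∪ B)) + #((I ∩ A) \ U₁) + #((I ∩ B) \ U₂) := by
  calc #(I \ (U₁ ∪ U₂)) ≤ #(((I ∪ D) \ (A ∪ B)) ∪ ((I ∩ A) \ U₁) ∪ ((I ∩ B) \ U₂)) := by
        refine card_le_card fun x hx => ?_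
        simp only [mem_sdiff, mem_union, mem_inter, not_or] at hx ⊢
        obtain ⟨hxI, hx1, hx2⟩ := hx
        by_cases hxA : x ∈ A
        · exact Or.inl (Or.inr ⟨⟨hxI, hxA⟩, hx1⟩)
        · by_cases hxB : x ∈ B
          · exact Or.inr ⟨⟨hxI, hxB⟩, hx2⟩
          · exact Or.inl (Or.inl ⟨Or.inl hxI, hxA, hxB⟩)
    _ ≤ _ := (card_union_le _ _).trans (Nat.add_le_add_right (card_union_le _ _) _)

/-- What the two children return is glued by the Union Lemma: `U₁ ⊆ A`, `U₂ ⊆ B` correctable and no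
generator meeting both `A` and `B` ⇒ `U₁ ∪ U₂` correctable.
[cite: BaspinEtAl2024, §3.2 Lemma 3.6, proof («Hence, Wᵢ is disconnected from Wⱼ for all i ≠ j. Therefore, by the Union Lemma, A is correctable»; chunk p0009 L27–29)] -/
theorem IsCorrectableRegion.union_of_decoupled {S : Submodule (ZMod 2) (SympVec n)}
    (hS : S = Submodule.span (ZMod 2) (Set.range g)) {A B U₁ U₂ : Finset (Fin n)} (hdec : Decoupled g A B)
    (hU₁ : U₁ ⊆ A) (hU₂ : U₂ ⊆ B) (h₁ : IsCorrectableRegion S U₁) (h₂ : IsCorrectableRegion S U₂) :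
    IsCorrectableRegion S (U₁ ∪ U₂) :=
  h₁.union g hS h₂ fun a ⟨q, hq, hqU₁⟩ q' hq' hq'U₂ => hdec a q hq q' hq' (hU₁ hqU₁) (hU₂ hq'U₂)

/-! ### The recursion: size splits and boundary splits, driven by a potential -/

section Real

open Real

variable {S : Submodule (ZMod 2) (SympVec n)} {k d : ℕ} {t : ℕ → ℕ} {C₁ c ρ θb : ℝ}

/-- **The division with small boundaries, as one recursion (Lemma 3.6's correctable set, by a
Frederickson-type potential argument in place of the cited r-division Lemma 2.10).** Regions `(I, D)`
(`D ⊇ ∂₊I`) are split with duplicated separators: by CARDINALITY while `|I|+|D| > ρ` (the tree's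
`1/2`-separations), by BOUNDARY COST while `|D| > θb` (Lipton–Tarjan's Corollary 3 with costs `1_D`);
a leaf (`|I|+|D| ≤ ρ`, `|D| ≤ θb`) has its interior certified correctable by Lemma 3.5 (`BaspinEtAl2024_lemma35_inv`,
cover `D`); the children's sets are glued by the Union Lemma. If a potential `Φ(|I|+|D|, |D|)` is
non-negative at leaves and pays for the separator at every split (hypotheses `hΦ₁`, `hΦ₂`), then every
region `(I, D)` contains a correctable `U ⊆ I` with `|I ∖ U| ≤ Φ(|I|+|D|, |D|)`.
[cite: BaspinEtAl2024, §3.2 Lemma 3.6 and its proof (arXiv:2307.03283 chunk p0009 L1–34), with Lemma 2.10 (= Henzinger–Klein–Rao–Subramanian 1997 Lemma 2.1, chunk p0006 L54–63) replaced by this recursion] -/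
theorem exists_correctable_interior_of_potential (hcode : IsAdditiveCode S k d)
    (hS : S = Submodule.span (ZMod 2) (Set.range g)) (hsep : IsHalfSeparable g t)
    (hcost : ∀ D W : Finset (Fin n), D ⊆ W → ∃ A B : Finset (Fin n), A ⊆ W ∧ B ⊆ W ∧ Disjoint A B ∧
      Decoupled g A B ∧ 2 * #(D ∩ A) ≤ #D ∧ 2 * #(D ∩ B) ≤ #D ∧ #(W \ (A ∪ B)) ≤ t #W)
    (htC : ∀ m : ℕ, (t m : ℝ) ≤ C₁ * (m : ℝ) ^ c) (hc : 0 < c) (Φ : ℕ → ℕ → ℝ)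
    (hleaf : ∀ m i : ℕ, (m : ℝ) ≤ ρ → (i : ℝ) ≤ θb →
      (i : ℝ) + C₁ / (1 - (2 : ℝ) ^ (-c)) * (m : ℝ) ^ c < d / 2)
    (hprog₁ : ∀ m : ℕ, ρ < m → 4 * t m < m) (hprog₂ : ∀ m : ℕ, (m : ℝ) ≤ ρ → (2 * t m : ℝ) ≤ θb)
    (hΦ₀ : ∀ m i : ℕ, (m : ℝ) ≤ ρ → 0 ≤ Φ m i)
    (hΦ₁ : ∀ m i mA iA mB iB σ : ℕ, ρ < m → σ ≤ t m → m ≤ 2 * mA → m ≤ 2 * mB → mA + mB = m + σ →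
      iA + iB ≤ i + 2 * σ → (σ : ℝ) + Φ mA iA + Φ mB iB ≤ Φ m i)
    (hΦ₂ : ∀ m i mA iA mB iB σ : ℕ, (m : ℝ) ≤ ρ → θb < i → σ ≤ t m → mA ≤ m → mB ≤ m →
      mA + mB = m + σ → 2 * iA ≤ i + 2 * σ → 2 * iB ≤ i + 2 * σ →
      (σ : ℝ) + Φ mA iA + Φ mB iB ≤ Φ m i) :
    ∀ (M : ℕ) (I D : Finset (Fin n)), #I + 2 * #D = M → Disjoint I D → CoversOuterBoundary g I D →
      ∃ U : Finset (Fin n), U ⊆ I ∧ IsCorrectableRegion S U ∧ (#(I \ U) : ℝ) ≤ Φ (#I + #D) #D := by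
  have hC₁ : 0 ≤ C₁ := (Nat.cast_nonneg (t 1)).trans (by simpa using htC 1)
  have hK0 : 0 ≤ C₁ / (1 - (2 : ℝ) ^ (-c)) :=
    div_nonneg hC₁ (sub_pos.2 (rpow_lt_one_of_one_lt_of_neg one_lt_two (neg_lt_zero.2 hc))).le
  intro M
  induction M using Nat.strong_induction_on with
  | _ M ih =>
    intro I D hM hID hcov
    have hW : #(I ∪ D) = #I + #D := card_union_of_disjoint hID
    by_cases hstop : ((#I + #D : ℕ) : ℝ) ≤ ρ ∧ ((#D : ℕ) : ℝ) ≤ θb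
    · -- a leaf: the interior is correctable by Lemma 3.5, nothing is lost
      refine ⟨I, Subset.rfl, BaspinEtAl2024_lemma35_inv g hcode hS hsep htC hc I D hcov ?_, ?_⟩
      · have h1 := hleaf _ _ hstop.1 hstop.2
        have h2 : (#I : ℝ) ^ c ≤ ((#I + #D : ℕ) : ℝ) ^ c :=
          rpow_le_rpow (Nat.cast_nonneg _) (by push_cast; linarith [(Nat.cast_nonneg #D : (0:ℝ) ≤ #D)]) hc.le
        have h3 := mul_le_mul_of_nonneg_left h2 hK0
        linarith
      · rw [sdiff_self, bot_eq_empty, card_empty, Nat.cast_zero]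
        exact hΦ₀ _ _ hstop.1
    · -- a split; the continuation common to both kinds of split
      have finish : ∀ A B : Finset (Fin n), A ⊆ I ∪ D → B ⊆ I ∪ D → Disjoint A B → Decoupled g A B →
          #(I ∩ A) + 2 * (#(D ∩ A) + #((I ∪ D) \ (A ∪ B))) < M →
          #(I ∩ B) + 2 * (#(D ∩ B) + #((I ∪ D) \ (A ∪ B))) < M →
          (#((I ∪ D) \ (A ∪ B)) : ℝ) +
              Φ (#A + #((I ∪ D) \ (A ∪ B))) (#(D ∩ A) + #((I ∪ D) \ (A ∪ B))) +
              Φ (#B + #((I ∪ D) \ (A ∪ B))) (#(D ∩ B) + #((I ∪ D) \ (A ∪ B))) ≤ Φ (#I + #D) #D →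
          ∃ U : Finset (Fin n), U ⊆ I ∧ IsCorrectableRegion S U ∧ (#(I \ U) : ℝ) ≤ Φ (#I + #D) #D := by
        intro A B hA hB hAB hdec hμA hμB hpot
        obtain ⟨hdisjA, hcovA, hcardA, hsumA⟩ := hcov.split_child g hID hA hdec
        obtain ⟨hdisjB, hcovB, hcardB, hsumB⟩ := hcov.split_child g hID hB (hdec.symm g)
        rw [union_comm B A] at hdisjB hcovB hcardB
        obtain ⟨U₁, hU₁, hU₁c, hU₁w⟩ := ih _ (by rw [hcardA]; exact hμA) _ _ rfl hdisjA hcovA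
        obtain ⟨U₂, hU₂, hU₂c, hU₂w⟩ := ih _ (by rw [hcardB]; exact hμB) _ _ rfl hdisjB hcovB
        refine ⟨U₁ ∪ U₂, union_subset (hU₁.trans inter_subset_left) (hU₂.trans inter_subset_left),
          IsCorrectableRegion.union_of_decoupled g hS hdec (hU₁.trans inter_subset_right)
            (hU₂.trans inter_subset_right) hU₁c hU₂c, ?_⟩
        have hle := card_interior_sdiff_union_le I D A B U₁ U₂
        have hleR : (#(I \ (U₁ ∪ U₂)) : ℝ) ≤
            #((I ∪ D) \ (A ∪ B)) + #((I ∩ A) \ U₁) + #((I ∩ B) \ U₂) := by exact_mod_cast hle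
        rw [hcardA, ← add_assoc, hsumA] at hU₁w
        rw [hcardB, ← add_assoc, hsumB] at hU₂w
        linarith
      by_cases hsize : ρ < ((#I + #D : ℕ) : ℝ)
      · -- size split: halve I ∪ D by cardinality
        obtain ⟨A, B, ⟨hA, hB, hAB, h2A, h2B, hdec⟩, hC⟩ := hsep (I ∪ D)
        rw [hW] at h2A h2B hC
        have hABC : #A + #B + #((I ∪ D) \ (A ∪ B)) = #I + #D := by
          rw [← hW, ← card_union_of_disjoint hAB, add_comm, card_sdiff_add_card_eq_card (union_subset hA hB)]
        have hprog := hprog₁ _ hsize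
        have hDA : #(D ∩ A) ≤ #D := card_le_card inter_subset_left
        have hDB : #(D ∩ B) ≤ #D := card_le_card inter_subset_left
        have hDAB : #(D ∩ A) + #(D ∩ B) ≤ #D := by
          rw [← card_union_of_disjoint (hAB.mono inter_subset_right inter_subset_right)]
          exact card_le_card (union_subset inter_subset_left inter_subset_left)
        obtain ⟨-, -, -, hsumA⟩ := hcov.split_child g hID hA hdec
        obtain ⟨-, -, -, hsumB⟩ := hcov.split_child g hID hB (hdec.symm g)
        refine finish A B hA hB hAB hdec (by omega) (by omega) ?_
        exact hΦ₁ (#I + #D) #D _ _ _ _ _ hsize hC (by omega) (by omega) (by omega) (by omega)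
      · -- boundary split: halve the boundary D by cost
        have hm : ((#I + #D : ℕ) : ℝ) ≤ ρ := not_lt.1 hsize
        have hbd : θb < ((#D : ℕ) : ℝ) := by
          by_contra h
          exact hstop ⟨hm, not_lt.1 h⟩
        obtain ⟨A, B, hA, hB, hAB, hdec, h2A, h2B, hC⟩ := hcost D (I ∪ D) subset_union_right
        rw [hW] at hC
        have hABC : #A + #B + #((I ∪ D) \ (A ∪ B)) = #I + #D := by
          rw [← hW, ← card_union_of_disjoint hAB, add_comm, card_sdiff_add_card_eq_card (union_subset hA hB)]
        have hprog : 2 * #((I ∪ D) \ (A ∪ B)) < #D := by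
          have h1 := hprog₂ _ hm
          have h2 : (2 * #((I ∪ D) \ (A ∪ B)) : ℝ) ≤ 2 * t (#I + #D) := by exact_mod_cast Nat.mul_le_mul_left 2 hC
          exact_mod_cast (h2.trans h1).trans_lt hbd
        have hIA : #(I ∩ A) ≤ #I := card_le_card inter_subset_left
        have hIB : #(I ∩ B) ≤ #I := card_le_card inter_subset_left
        have hDAB : #(D ∩ A) + #(D ∩ B) ≤ #D := by
          rw [← card_union_of_disjoint (hAB.mono inter_subset_right inter_subset_right)]
          exact card_le_card (union_subset inter_subset_left inter_subset_left)
        have hAW : #A + #((I ∪ D) \ (A ∪ B)) ≤ #I + #D := by omega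
        have hBW : #B + #((I ∪ D) \ (A ∪ B)) ≤ #I + #D := by omega
        refine finish A B hA hB hAB hdec (by omega) (by omega) ?_
        exact hΦ₂ (#I + #D) #D _ _ _ _ _ hm hbd hC hAW hBW (by omega) (by omega) (by omega)

/-! ### The potential -/

/-- Bookkeeping for the boundary part `max(i − θ, 0)` of the potential at a size split: it is
subadditive in `i`. [folklore] -/
private theorem posPart_add_le {x y θ : ℝ} (hx : 0 ≤ x) (hy : 0 ≤ y) (hθ : 0 ≤ θ) :
    max (x - θ) 0 + max (y - θ) 0 ≤ max (x + y - θ) 0 := by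
  rcases le_or_gt θ x with hxθ | hxθ
  · rw [max_eq_left (by linarith : (0 : ℝ) ≤ x - θ)]
    rcases le_or_gt θ y with hyθ | hyθ
    · rw [max_eq_left (by linarith : (0 : ℝ) ≤ y - θ), max_eq_left (by linarith : (0 : ℝ) ≤ x + y - θ)]
      linarith
    · rw [max_eq_right (by linarith : y - θ ≤ 0), max_eq_left (by linarith : (0 : ℝ) ≤ x + y - θ)]
      linarith
  · rw [max_eq_right (by linarith : x - θ ≤ 0), zero_add]
    exact max_le_max (by linarith) le_rfl

/-- Bookkeeping for the boundary part of the potential at a boundary split (Frederickson's second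
phase: a region with `i > 6σ₀` boundary vertices is split with both halves getting at most `i/2 + σ`
old-plus-new boundary vertices, `σ ≤ σ₀` new ones each; the drop of `max(i − 4σ₀, 0)` pays `2σ`).
[folklore] -/
private theorem posPart_bdry {i iA iB σ σ₀ : ℝ} (hσ : 0 ≤ σ) (hσ₀ : σ ≤ σ₀) (hi : 6 * σ₀ < i)
    (h2A : 2 * iA ≤ i + 2 * σ) (h2B : 2 * iB ≤ i + 2 * σ) :
    2 * σ + max (iA - 4 * σ₀) 0 + max (iB - 4 * σ₀) 0 ≤ max (i - 4 * σ₀) 0 := by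
  rw [max_eq_left (by linarith : (0 : ℝ) ≤ i - 4 * σ₀)]
  rcases le_or_gt (iA - 4 * σ₀) 0 with hA | hA <;> rcases le_or_gt (iB - 4 * σ₀) 0 with hB | hB
  · rw [max_eq_right hA, max_eq_right hB]; linarith
  · rw [max_eq_right hA, max_eq_left hB.le]; linarith
  · rw [max_eq_left hA.le, max_eq_right hB]; linarith
  · rw [max_eq_left hA.le, max_eq_left hB.le]; linarith

/-- **A potential that pays for the recursion** (Frederickson's accounting, both phases at once). With
`ε = 2^{1−c} − 1`, `b = 4C₁/ε`, `a = 2b`, `σ₀ = C₁ρ^c` and the size threshold `ρ` subject to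
`a·ρ^{c−1} ≤ 1`, the function
`Φ(m, i) = a·m·ρ^{c−1} − b·g(m) + max(i − 4σ₀, 0)`, `g(m) = 2^{1−c}ρ^{c−1}·m` for `m ≤ ρ` and `m^c` for
`m > ρ`, is non-negative for `m ≤ ρ`, decreases by at least the separator size `σ ≤ t(m) ≤ C₁m^c` at a
size split (`m > ρ`; children of size `≥ m/2`, so `g ≥ 2^{−c}m^c` on them and `b(2^{1−c} − 1)m^c = 4C₁m^c`
pays `σ + aσρ^{c−1} + 2σ ≤ 4σ`) and at a boundary split (`m ≤ ρ`, all in the linear branch; `i > 6σ₀`),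
and `Φ(m, 0) ≤ a·m·ρ^{c−1}`. [folklore] (the two-phase accounting of G. N. Frederickson, SIAM J. Comput.
16 (1987) 1004–1022, Lemmas 1–2, merged into one potential; cf. C. Wulff-Nilsen, arXiv:1008.1048 §3.1,
Lemma 4) -/
private theorem exists_division_potential (hC₁ : 0 ≤ C₁) (hc0 : 0 < c) (hc1 : c < 1) (hρ : 0 < ρ)
    (haρ : 8 * C₁ / ((2 : ℝ) ^ (1 - c) - 1) * ρ ^ (c - 1) ≤ 1)
    (htC : ∀ m : ℕ, (t m : ℝ) ≤ C₁ * (m : ℝ) ^ c) :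
    ∃ Φ : ℕ → ℕ → ℝ,
      (∀ m i : ℕ, (m : ℝ) ≤ ρ → 0 ≤ Φ m i) ∧
      (∀ m i mA iA mB iB σ : ℕ, ρ < m → σ ≤ t m → m ≤ 2 * mA → m ≤ 2 * mB → mA + mB = m + σ →
        iA + iB ≤ i + 2 * σ → (σ : ℝ) + Φ mA iA + Φ mB iB ≤ Φ m i) ∧
      (∀ m i mA iA mB iB σ : ℕ, (m : ℝ) ≤ ρ → 6 * C₁ * ρ ^ c < i → σ ≤ t m → mA ≤ m → mB ≤ m →
        mA + mB = m + σ → 2 * iA ≤ i + 2 * σ → 2 * iB ≤ i + 2 * σ →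
        (σ : ℝ) + Φ mA iA + Φ mB iB ≤ Φ m i) ∧
      (∀ m : ℕ, Φ m 0 ≤ 8 * C₁ / ((2 : ℝ) ^ (1 - c) - 1) * m * ρ ^ (c - 1)) := by
  have h2c : (2 : ℝ) ^ (1 - c) = 2 * (2 : ℝ) ^ (-c) := by
    rw [sub_eq_add_neg, rpow_add two_pos, rpow_one]
  have hε0 : 0 < (2 : ℝ) ^ (1 - c) - 1 := sub_pos.2 (one_lt_rpow one_lt_two (by linarith))
  have hε2 : (2 : ℝ) ^ (1 - c) ≤ 2 := by
    have h := rpow_le_rpow_of_exponent_le one_le_two (show 1 - c ≤ (1 : ℝ) by linarith)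
    rwa [rpow_one] at h
  have ht0 : 0 < (2 : ℝ) ^ (-c) := rpow_pos_of_pos two_pos _
  set ε : ℝ := (2 : ℝ) ^ (1 - c) - 1 with hε
  set L : ℝ := ρ ^ (c - 1) with hL
  have hL0 : 0 < L := rpow_pos_of_pos hρ _
  set a : ℝ := 8 * C₁ / ε with ha
  set b : ℝ := 4 * C₁ / ε with hb
  have hab : a = 2 * b := by rw [ha, hb]; ring
  have hb0 : 0 ≤ b := div_nonneg (by linarith) hε0.le
  have hbε : b * ε = 4 * C₁ := div_mul_cancel₀ _ hε0.ne'
  have haL : a * L ≤ 1 := haρ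
  set μ : ℝ := (2 : ℝ) ^ (1 - c) * L with hμ
  set σ₀ : ℝ := C₁ * ρ ^ c with hσ₀
  have hσ₀0 : 0 ≤ σ₀ := mul_nonneg hC₁ (rpow_nonneg hρ.le _)
  have h6 : 6 * C₁ * ρ ^ c = 6 * σ₀ := by rw [hσ₀]; ring
  have hcoef : a * L - b * μ = b * L * (2 - (2 : ℝ) ^ (1 - c)) := by rw [hab, hμ]; ring
  have hcoef0 : 0 ≤ a * L - b * μ := by
    rw [hcoef]; exact mul_nonneg (mul_nonneg hb0 hL0.le) (by linarith)
  have hcoef1 : a * L - b * μ ≤ 1 := by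
    have : 0 ≤ b * μ := mul_nonneg hb0 (mul_nonneg (rpow_nonneg zero_le_two _) hL0.le)
    linarith
  refine ⟨fun m i => a * m * L - b * (if (m : ℝ) ≤ ρ then μ * m else (m : ℝ) ^ c) +
    max ((i : ℝ) - 4 * σ₀) 0, ?_, ?_, ?_, ?_⟩
  · -- non-negative on small regions (the leaves)
    intro m i hm
    dsimp only
    rw [if_pos hm]
    have h1 : 0 ≤ max ((i : ℝ) - 4 * σ₀) 0 := le_max_right _ _
    have h2 : a * m * L - b * (μ * m) = (a * L - b * μ) * m := by ring
    rw [h2]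
    exact add_nonneg (mul_nonneg hcoef0 (Nat.cast_nonneg _)) h1
  · -- size split
    intro m i mA iA mB iB σ hm hσ h2A h2B hsum hi
    dsimp only
    have hm0 : (0 : ℝ) < m := hρ.trans hm
    have hmc : (m : ℝ) ^ c ≤ L * m := by
      have h1 : (m : ℝ) ^ c = (m : ℝ) ^ (c - 1) * m := by
        conv_lhs => rw [show c = (c - 1) + 1 by ring, rpow_add hm0, rpow_one]
      rw [h1]
      exact mul_le_mul_of_nonneg_right (rpow_le_rpow_of_nonpos hρ hm.le (by linarith)) hm0.le
    -- the children: g ≥ 2^{-c} m^c in either branch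
    have hchild : ∀ m' : ℕ, m ≤ 2 * m' →
        (2 : ℝ) ^ (-c) * (m : ℝ) ^ c ≤ (if (m' : ℝ) ≤ ρ then μ * m' else (m' : ℝ) ^ c) := by
      intro m' hmm'
      have hmm'R : (m : ℝ) ≤ 2 * m' := by exact_mod_cast hmm'
      split_ifs with hm'
      · rw [hμ, h2c]
        calc (2 : ℝ) ^ (-c) * (m : ℝ) ^ c ≤ (2 : ℝ) ^ (-c) * (L * m) := mul_le_mul_of_nonneg_left hmc ht0.le
          _ ≤ (2 : ℝ) ^ (-c) * (L * (2 * m')) :=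
              mul_le_mul_of_nonneg_left (mul_le_mul_of_nonneg_left hmm'R hL0.le) ht0.le
          _ = 2 * (2 : ℝ) ^ (-c) * L * m' := by ring
      · have h1 : (m : ℝ) / 2 ≤ m' := by linarith
        calc (2 : ℝ) ^ (-c) * (m : ℝ) ^ c = ((m : ℝ) / 2) ^ c := by
              rw [div_rpow hm0.le zero_le_two, rpow_neg zero_le_two, div_eq_mul_inv, mul_comm]
          _ ≤ (m' : ℝ) ^ c := rpow_le_rpow (by positivity) h1 hc0.le
    have hgA := mul_le_mul_of_nonneg_left (hchild mA h2A) hb0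
    have hgB := mul_le_mul_of_nonneg_left (hchild mB h2B) hb0
    rw [if_neg (not_le.2 hm)]
    have hsumR : (mA : ℝ) + mB = m + σ := by exact_mod_cast hsum
    have hiR : (iA : ℝ) + iB ≤ i + 2 * σ := by exact_mod_cast hi
    have hσR : (σ : ℝ) ≤ C₁ * (m : ℝ) ^ c := (Nat.cast_le.2 hσ).trans (htC m)
    have hσ0 : (0 : ℝ) ≤ σ := Nat.cast_nonneg _
    have hmax : max ((iA : ℝ) - 4 * σ₀) 0 + max ((iB : ℝ) - 4 * σ₀) 0 ≤
        max ((i : ℝ) - 4 * σ₀) 0 + 2 * σ := by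
      refine (posPart_add_le (Nat.cast_nonneg _) (Nat.cast_nonneg _) (by linarith)).trans (max_le ?_ ?_)
      · linarith [le_max_left ((i : ℝ) - 4 * σ₀) 0]
      · linarith [le_max_right ((i : ℝ) - 4 * σ₀) 0]
    have hsum' : a * (mA : ℝ) * L + a * mB * L = a * m * L + a * σ * L := by
      calc a * (mA : ℝ) * L + a * mB * L = a * L * ((mA : ℝ) + mB) := by ring
        _ = a * L * (m + σ) := by rw [hsumR]
        _ = a * m * L + a * σ * L := by ring
    have hkey : (σ : ℝ) + a * σ * L + 2 * σ + b * (m : ℝ) ^ c ≤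
        b * ((2 : ℝ) ^ (-c) * (m : ℝ) ^ c) + b * ((2 : ℝ) ^ (-c) * (m : ℝ) ^ c) := by
      have h1 : b * ((2 : ℝ) ^ (-c) * (m : ℝ) ^ c) + b * ((2 : ℝ) ^ (-c) * (m : ℝ) ^ c) - b * (m : ℝ) ^ c =
          4 * C₁ * (m : ℝ) ^ c := by
        rw [← hbε, hε, h2c]; ring
      have h2 : a * σ * L ≤ σ := by nlinarith [haL, hσ0]
      linarith
    linarith
  · -- boundary split
    intro m i mA iA mB iB σ hm hi hσ hmA hmB hsum h2A h2B
    dsimp only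
    rw [h6] at hi
    have hmAρ : (mA : ℝ) ≤ ρ := (Nat.cast_le.2 hmA).trans hm
    have hmBρ : (mB : ℝ) ≤ ρ := (Nat.cast_le.2 hmB).trans hm
    rw [if_pos hm, if_pos hmAρ, if_pos hmBρ]
    have hsumR : (mA : ℝ) + mB = m + σ := by exact_mod_cast hsum
    have hσ0 : (0 : ℝ) ≤ σ := Nat.cast_nonneg _
    have hm0 : (0 : ℝ) ≤ m := Nat.cast_nonneg _
    have hσσ₀ : (σ : ℝ) ≤ σ₀ := by
      refine (Nat.cast_le.2 hσ).trans ((htC m).trans ?_)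
      exact mul_le_mul_of_nonneg_left (rpow_le_rpow hm0 hm hc0.le) hC₁
    have h2A' : 2 * (iA : ℝ) ≤ i + 2 * σ := by exact_mod_cast h2A
    have h2B' : 2 * (iB : ℝ) ≤ i + 2 * σ := by exact_mod_cast h2B
    have hpos := posPart_bdry hσ0 hσσ₀ hi h2A' h2B'
    have h1 : a * (mA : ℝ) * L - b * (μ * mA) + (a * mB * L - b * (μ * mB)) - (a * m * L - b * (μ * m)) =
        (a * L - b * μ) * σ := by
      have : (a * L - b * μ) * σ = (a * L - b * μ) * ((mA : ℝ) + mB - m) := by rw [hsumR]; ring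
      rw [this]; ring
    have h2 : (a * L - b * μ) * σ ≤ σ := by nlinarith [hcoef1, hσ0]
    linarith
  · -- at the root
    intro m
    dsimp only
    rw [Nat.cast_zero, zero_sub, max_eq_right (by linarith : -(4 * σ₀) ≤ 0), add_zero]
    have hg : 0 ≤ (if (m : ℝ) ≤ ρ then μ * m else (m : ℝ) ^ c) := by
      split_ifs
      · exact mul_nonneg (mul_nonneg (rpow_nonneg zero_le_two _) hL0.le) (Nat.cast_nonneg _)
      · exact rpow_nonneg (Nat.cast_nonneg _) _
    have := mul_nonneg hb0 hg
    linarith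

/-! ### From the printed separability hypothesis -/

variable {p q : ℕ} {s : ℕ → ℕ}

/-- **Halving a boundary by cost** (Lipton–Tarjan Corollary 3 with the cost `1_D`, from the tree's
`IsSeparableWith.exists_costHalves`): for `D ⊆ W` there is a separation of `W` each of whose sides holds
at most half of `D`, with separator `≤ t(|W|)`, `t = divSum s p q` — Frederickson's boundary-weighted
separation. [cite: LiptonTarjan1979, Corollary 3 (PDF p. 15 L1–12)] -/
theorem IsSeparableWith.exists_boundaryHalves (hsep : IsSeparableWith g p q s) (hpq : p < q)
    (hs : Monotone s) (D W : Finset (Fin n)) (hDW : D ⊆ W) :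
    ∃ A B : Finset (Fin n), A ⊆ W ∧ B ⊆ W ∧ Disjoint A B ∧ Decoupled g A B ∧
      2 * #(D ∩ A) ≤ #D ∧ 2 * #(D ∩ B) ≤ #D ∧ #(W \ (A ∪ B)) ≤ divSum s p q hpq #W := by
  classical
  obtain ⟨A, B, hA, hB, hAB, hdec, h2A, h2B, hC⟩ :=
    hsep.exists_costHalves g hpq hs (fun v => if v ∈ D then 1 else 0) W
  have hsum : ∀ X : Finset (Fin n), (∑ v ∈ X, if v ∈ D then 1 else 0) = #(D ∩ X) := fun X => by
    rw [Finset.sum_boole, Nat.cast_id, Finset.filter_mem_eq_inter, inter_comm]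
  rw [hsum, hsum, inter_eq_left.2 hDW] at h2A h2B
  exact ⟨A, B, hA, hB, hAB, hdec, h2A, h2B, hC⟩

/-! ### Lemma 3.6 with an explicit radius -/

variable {C : ℝ}

/-- `2^{1−c} − 1 ∈ (0, 1]` for `0 < c < 1`. [folklore] -/
private theorem two_rpow_one_sub_bounds (hc0 : 0 < c) (hc1 : c < 1) :
    0 < (2 : ℝ) ^ (1 - c) - 1 ∧ (2 : ℝ) ^ (1 - c) - 1 ≤ 1 := by
  refine ⟨sub_pos.2 (one_lt_rpow one_lt_two (by linarith)), ?_⟩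
  have h := rpow_le_rpow_of_exponent_le one_le_two (show 1 - c ≤ (1 : ℝ) by linarith)
  rw [rpow_one] at h
  linarith

/-- **Baspin–Guruswami–Krishna–Li, Lemma 3.6, with an explicit radius.** Let `S̄ = ⟨g⟩` be an
`[[n,k,d]]` stabilizer code whose connectivity graph is `(s, p/q)`-separable (`p < q`) with
`s(m) ≤ C·m^c`, `0 < c < 1`; put `C₁ = C/(1 − (p/q)^c)`, `ε = 2^{1−c} − 1`, `a = 8C₁/ε`,
`K = C₁/(1 − 2^{−c})`. For every radius `ρ > 0` with `a·ρ^{c−1} ≤ 1` and `(6C₁ + K)·ρ^c < d/2` there is a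
correctable set `U` with `|V ∖ U| ≤ a·n·ρ^{c−1}` («There exists a d-correctable set A such that
|V∖A| ≤ (αn)/(d^{(1−c)/c})», there with `r = (εd)^{1/c}` pieces of an r-division; here the pieces are the
leaves of the recursion `exists_correctable_interior_of_potential`, each of size `≤ ρ` with boundary
`≤ 6C₁ρ^c`, certified by Lemma 3.5). [cite: BaspinEtAl2024, §3.2 Lemma 3.6 (arXiv:2307.03283 chunk p0009 L1–5; proof L6–34)] -/
theorem BaspinEtAl2024_lemma36_radius (hcode : IsAdditiveCode S k d)
    (hS : S = Submodule.span (ZMod 2) (Set.range g)) (hsep : IsSeparableWith g p q s) (hpq : p < q)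
    (hsC : ∀ m : ℕ, (s m : ℝ) ≤ C * (m : ℝ) ^ c) (hc0 : 0 < c) (hc1 : c < 1) (hρ : 0 < ρ)
    (hρa : 8 * (C / (1 - ((p : ℝ) / q) ^ c)) / ((2 : ℝ) ^ (1 - c) - 1) * ρ ^ (c - 1) ≤ 1)
    (hρd : (6 * (C / (1 - ((p : ℝ) / q) ^ c)) + C / (1 - ((p : ℝ) / q) ^ c) / (1 - (2 : ℝ) ^ (-c))) *
      ρ ^ c < d / 2) :
    ∃ U : Finset (Fin n), IsCorrectableRegion S U ∧
      (#Uᶜ : ℝ) ≤ 8 * (C / (1 - ((p : ℝ) / q) ^ c)) / ((2 : ℝ) ^ (1 - c) - 1) * n * ρ ^ (c - 1) := by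
  set C₁ : ℝ := C / (1 - ((p : ℝ) / q) ^ c) with hC₁
  obtain ⟨hε0, hε1⟩ := two_rpow_one_sub_bounds hc0 hc1
  obtain ⟨s', hs'mono, hss', hs'C⟩ := exists_monotone_ge_le_rpow hsC hc0.le
  have hsep' : IsSeparableWith g p q s' := hsep.mono g hss'
  have htC : ∀ m : ℕ, (divSum s' p q hpq m : ℝ) ≤ C₁ * (m : ℝ) ^ c := divSum_le_linear hpq hs'C hc0
  have hhalf : IsHalfSeparable g (divSum s' p q hpq) := hsep'.isHalfSeparable g hpq hs'mono
  have hC₁0 : 0 ≤ C₁ := (Nat.cast_nonneg _).trans (by simpa using htC 1)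
  have hK0 : 0 ≤ C₁ / (1 - (2 : ℝ) ^ (-c)) :=
    div_nonneg hC₁0 (sub_pos.2 (rpow_lt_one_of_one_lt_of_neg one_lt_two (neg_lt_zero.2 hc0))).le
  obtain ⟨Φ, hΦ₀, hΦ₁, hΦ₂, hΦroot⟩ := exists_division_potential hC₁0 hc0 hc1 hρ hρa htC
  -- `a ≤ ρ^{1-c}`, hence `4C₁ ≤ ρ^{1-c}/2`
  have hρpow : ρ ^ (c - 1) * ρ ^ (1 - c) = 1 := by
    rw [← rpow_add hρ, show c - 1 + (1 - c) = (0 : ℝ) by ring, rpow_zero]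
  have haρ' : 8 * C₁ / ((2 : ℝ) ^ (1 - c) - 1) ≤ ρ ^ (1 - c) := by
    have h := mul_le_mul_of_nonneg_right hρa (rpow_nonneg hρ.le (1 - c))
    rwa [mul_assoc, hρpow, mul_one, one_mul] at h
  have ha8 : 8 * C₁ ≤ 8 * C₁ / ((2 : ℝ) ^ (1 - c) - 1) := by
    rw [le_div_iff₀ hε0]; nlinarith
  have hprog₁ : ∀ m : ℕ, ρ < m → 4 * divSum s' p q hpq m < m := by
    intro m hm
    have hm0 : 0 < (m : ℝ) := hρ.trans hm
    have hmc0 : 0 < (m : ℝ) ^ c := rpow_pos_of_pos hm0 _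
    have h2 : ρ ^ (1 - c) ≤ (m : ℝ) ^ (1 - c) := rpow_le_rpow hρ.le hm.le (by linarith)
    have h3 : (m : ℝ) ^ (1 - c) * (m : ℝ) ^ c = m := by
      rw [← rpow_add hm0, show 1 - c + c = (1 : ℝ) by ring, rpow_one]
    have h : (4 * divSum s' p q hpq m : ℝ) < m := by
      calc (4 * divSum s' p q hpq m : ℝ) ≤ 4 * C₁ * (m : ℝ) ^ c := by linarith [htC m]
        _ ≤ ρ ^ (1 - c) / 2 * (m : ℝ) ^ c := mul_le_mul_of_nonneg_right (by linarith) hmc0.le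
        _ ≤ (m : ℝ) ^ (1 - c) / 2 * (m : ℝ) ^ c := mul_le_mul_of_nonneg_right (by linarith) hmc0.le
        _ = m / 2 := by rw [div_mul_eq_mul_div, h3]
        _ < m := by linarith
    exact_mod_cast h
  have hprog₂ : ∀ m : ℕ, (m : ℝ) ≤ ρ → (2 * divSum s' p q hpq m : ℝ) ≤ 6 * C₁ * ρ ^ c := by
    intro m hm
    have h1 : (m : ℝ) ^ c ≤ ρ ^ c := rpow_le_rpow (Nat.cast_nonneg _) hm hc0.le
    have h2 := mul_le_mul_of_nonneg_left h1 hC₁0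
    have h3 : 0 ≤ C₁ * ρ ^ c := mul_nonneg hC₁0 (rpow_nonneg hρ.le _)
    linarith [htC m]
  have hleaf : ∀ m i : ℕ, (m : ℝ) ≤ ρ → (i : ℝ) ≤ 6 * C₁ * ρ ^ c →
      (i : ℝ) + C₁ / (1 - (2 : ℝ) ^ (-c)) * (m : ℝ) ^ c < d / 2 := by
    intro m i hm hi
    have h1 : (m : ℝ) ^ c ≤ ρ ^ c := rpow_le_rpow (Nat.cast_nonneg _) hm hc0.le
    have h2 := mul_le_mul_of_nonneg_left h1 hK0
    linarith
  obtain ⟨U, -, hU, hw⟩ := exists_correctable_interior_of_potential g (ρ := ρ) (θb := 6 * C₁ * ρ ^ c)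
    hcode hS hhalf (fun D W hDW => hsep'.exists_boundaryHalves g hpq hs'mono D W hDW) htC hc0 Φ hleaf
    hprog₁ hprog₂ hΦ₀ hΦ₁ hΦ₂ _ univ ∅ rfl (disjoint_empty_right _) (coversOuterBoundary_univ g ∅)
  refine ⟨U, hU, ?_⟩
  rw [card_empty, add_zero, card_univ, Fintype.card_fin, ← compl_eq_univ_sdiff] at hw
  exact hw.trans (hΦroot n)

/-- **Lemma 3.4 / Theorem «thm:main» with an explicit radius: the dimension bound.** Under the
hypotheses of `BaspinEtAl2024_lemma36_radius` and `d ≥ 1`: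
`k ≤ M · (a·n·ρ^{c−1}) · d^{c−1}`, `M = C₁·2^{1−c}/(2^{1−c} − 1)` — the printed second step: separate
`V ∖ A` recursively into decoupled blocks of size `< d` (Baspin–Krishna Lemma 21, the tree's
`BaspinKrishna2022_lemma21`, `|C| ≤ 𝒮_d(|V ∖ A|) ≤ M·|V ∖ A|·d^{c−1}`) and apply `k ≤ |C|`
(Bravyi–Poulin–Terhal, the tree's `le_card_compl_of_isCorrectable`) («Apply Lemma 3.3 to the subgraph
G[V∖A] … |C| ≤ α·n/d^{(1−c)+(1−c)/c}»).
[cite: BaspinEtAl2024, §3.2 Lemma 3.4 (chunk p0008 L3–8) and proof of Lemma 3.4 (chunk p0009 L50–68)] -/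
theorem BaspinEtAl2024_lemma34_radius (hcode : IsAdditiveCode S k d)
    (hS : S = Submodule.span (ZMod 2) (Set.range g)) (hsep : IsSeparableWith g p q s) (hpq : p < q)
    (hsC : ∀ m : ℕ, (s m : ℝ) ≤ C * (m : ℝ) ^ c) (hc0 : 0 < c) (hc1 : c < 1) (hd : 1 ≤ d) (hρ : 0 < ρ)
    (hρa : 8 * (C / (1 - ((p : ℝ) / q) ^ c)) / ((2 : ℝ) ^ (1 - c) - 1) * ρ ^ (c - 1) ≤ 1)
    (hρd : (6 * (C / (1 - ((p : ℝ) / q) ^ c)) + C / (1 - ((p : ℝ) / q) ^ c) / (1 - (2 : ℝ) ^ (-c))) *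
      ρ ^ c < d / 2) :
    (k : ℝ) ≤ C / (1 - ((p : ℝ) / q) ^ c) * (2 : ℝ) ^ (1 - c) / ((2 : ℝ) ^ (1 - c) - 1) *
      (8 * (C / (1 - ((p : ℝ) / q) ^ c)) / ((2 : ℝ) ^ (1 - c) - 1) * n * ρ ^ (c - 1)) *
      (d : ℝ) ^ (c - 1) := by
  obtain ⟨U, hU, hUc⟩ := BaspinEtAl2024_lemma36_radius g hcode hS hsep hpq hsC hc0 hc1 hρ hρa hρd
  set C₁ : ℝ := C / (1 - ((p : ℝ) / q) ^ c) with hC₁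
  obtain ⟨hε0, -⟩ := two_rpow_one_sub_bounds hc0 hc1
  obtain ⟨s', hs'mono, hss', hs'C⟩ := exists_monotone_ge_le_rpow hsC hc0.le
  have hsep' : IsSeparableWith g p q s' := hsep.mono g hss'
  have htC : ∀ m : ℕ, (divSum s' p q hpq m : ℝ) ≤ C₁ * (m : ℝ) ^ c := divSum_le_linear hpq hs'C hc0
  have hhalf : IsHalfSeparable g (divSum s' p q hpq) := hsep'.isHalfSeparable g hpq hs'mono
  have hC₁0 : 0 ≤ C₁ := (Nat.cast_nonneg _).trans (by simpa using htC 1)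
  -- second separation: blocks of size < d inside Uᶜ
  obtain ⟨β, hβ, hcnt⟩ := BaspinKrishna2022_lemma21 g hhalf (divSum_mono hs'mono hpq) hd Uᶜ
  have hB := hβ.isCorrectableRegion g hcode hS
  have hk := le_card_compl_of_isCorrectable hcode hU hB
  have hsub : (U ∪ univ.filter fun x => (β x).isSome)ᶜ ⊆ Uᶜ.filter fun x => β x = none := by
    intro x hx
    rw [mem_compl, mem_union, not_or, mem_filter] at hx
    obtain ⟨h1, h2⟩ := hx
    simp only [mem_univ, true_and, Bool.not_eq_true, Option.isSome_eq_false_iff,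
      Option.isNone_iff_eq_none] at h2
    exact mem_filter.2 ⟨mem_compl.2 h1, h2⟩
  have hM := sepSum_le_linear hC₁0 hc0.le hc1 htC hd #Uᶜ
  have hM0 : 0 ≤ C₁ * (2 : ℝ) ^ (1 - c) / ((2 : ℝ) ^ (1 - c) - 1) :=
    div_nonneg (mul_nonneg hC₁0 (rpow_nonneg zero_le_two _)) hε0.le
  have hdc : 0 < (d : ℝ) ^ (c - 1) := rpow_pos_of_pos (by exact_mod_cast hd) _
  calc (k : ℝ) ≤ #(U ∪ univ.filter fun x => (β x).isSome)ᶜ := by exact_mod_cast hk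
    _ ≤ #(Uᶜ.filter fun x => β x = none) := by exact_mod_cast card_le_card hsub
    _ ≤ sepSum (divSum s' p q hpq) d #Uᶜ := by exact_mod_cast hcnt
    _ ≤ C₁ * (2 : ℝ) ^ (1 - c) / ((2 : ℝ) ^ (1 - c) - 1) * #Uᶜ * (d : ℝ) ^ (c - 1) := hM
    _ ≤ _ := mul_le_mul_of_nonneg_right (mul_le_mul_of_nonneg_left hUc hM0) hdc.le

/-! ### The radius `ρ = (δd)^{1/c}` and the printed statements -/

/-- **Choice of the radius.** With `K = C₁/(1 − 2^{−c})`, `a = 8C₁/(2^{1−c} − 1)`, `N = 4(6C₁ + K) + 4`: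
for `d ≥ N·(a+1)^{c/(1−c)}` the radius `ρ = (d/N)^{1/c}` satisfies `a·ρ^{c−1} ≤ 1`, `(6C₁ + K)ρ^c < d/2`
and `ρ^{c−1} = N^{(1−c)/c}·d^{(c−1)/c}` (the printed `r = (εd)^{1/c}`, `ε = min(ε', 1/(4βα))`).
[cite: BaspinEtAl2024, §3.2 Lemma 3.6, proof («By Lemma 2.10 with r ≔ (εd)^{1/c}»; chunk p0009 L7–16)] -/
theorem exists_division_radius (hC₁ : 0 ≤ C₁) (hc0 : 0 < c) (hc1 : c < 1) {d : ℕ}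
    (hd₀ : (4 * (6 * C₁ + C₁ / (1 - (2 : ℝ) ^ (-c))) + 4) *
      (8 * C₁ / ((2 : ℝ) ^ (1 - c) - 1) + 1) ^ (c / (1 - c)) ≤ d) :
    ∃ ρ : ℝ, 0 < ρ ∧ 8 * C₁ / ((2 : ℝ) ^ (1 - c) - 1) * ρ ^ (c - 1) ≤ 1 ∧
      (6 * C₁ + C₁ / (1 - (2 : ℝ) ^ (-c))) * ρ ^ c < d / 2 ∧
      ρ ^ (c - 1) = (4 * (6 * C₁ + C₁ / (1 - (2 : ℝ) ^ (-c))) + 4) ^ ((1 - c) / c) *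
        (d : ℝ) ^ ((c - 1) / c) := by
  obtain ⟨hε0, -⟩ := two_rpow_one_sub_bounds hc0 hc1
  have hK0 : 0 ≤ C₁ / (1 - (2 : ℝ) ^ (-c)) :=
    div_nonneg hC₁ (sub_pos.2 (rpow_lt_one_of_one_lt_of_neg one_lt_two (neg_lt_zero.2 hc0))).le
  set K : ℝ := C₁ / (1 - (2 : ℝ) ^ (-c)) with hK
  set a : ℝ := 8 * C₁ / ((2 : ℝ) ^ (1 - c) - 1) with ha
  set N : ℝ := 4 * (6 * C₁ + K) + 4 with hN
  have ha0 : 0 ≤ a := div_nonneg (by linarith) hε0.le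
  have hN0 : 0 < N := by rw [hN]; nlinarith
  have ha1 : 0 < a + 1 := by linarith
  have hpow1 : 1 ≤ (a + 1) ^ (c / (1 - c)) := one_le_rpow (by linarith) (div_nonneg hc0.le (by linarith))
  have hd0 : 0 < (d : ℝ) := by nlinarith
  have hx0 : 0 < (d : ℝ) / N := div_pos hd0 hN0
  refine ⟨((d : ℝ) / N) ^ (1 / c), rpow_pos_of_pos hx0 _, ?_, ?_, ?_⟩
  · -- a ρ^{c-1} ≤ a (a+1)^{-1} ≤ 1
    rw [← rpow_mul hx0.le, show 1 / c * (c - 1) = (c - 1) / c by field_simp]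
    have h1 : (a + 1) ^ (c / (1 - c)) ≤ (d : ℝ) / N := by
      rw [le_div_iff₀ hN0, mul_comm]; exact hd₀
    have h2 : ((d : ℝ) / N) ^ ((c - 1) / c) ≤ ((a + 1) ^ (c / (1 - c))) ^ ((c - 1) / c) :=
      rpow_le_rpow_of_nonpos (rpow_pos_of_pos ha1 _) h1
        (div_nonpos_of_nonpos_of_nonneg (by linarith) hc0.le)
    have h3 : ((a + 1) ^ (c / (1 - c))) ^ ((c - 1) / c) = (a + 1)⁻¹ := by
      have h1c : (1 - c) ≠ 0 := sub_ne_zero.2 hc1.ne'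
      rw [← rpow_mul ha1.le, show c / (1 - c) * ((c - 1) / c) = -1 by field_simp; ring, rpow_neg_one]
    rw [h3] at h2
    calc a * ((d : ℝ) / N) ^ ((c - 1) / c) ≤ a * (a + 1)⁻¹ := mul_le_mul_of_nonneg_left h2 ha0
      _ ≤ 1 := by rw [← div_eq_mul_inv, div_le_one ha1]; linarith
  · -- (6C₁ + K) ρ^c = (6C₁+K) d / N ≤ d/4 < d/2
    rw [← rpow_mul hx0.le, show 1 / c * c = 1 by field_simp, rpow_one]
    have h1 : (6 * C₁ + K) * ((d : ℝ) / N) ≤ d / 4 := by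
      rw [mul_div_assoc', div_le_div_iff₀ hN0 (by norm_num : (0:ℝ) < 4), hN]
      nlinarith
    linarith
  · rw [← rpow_mul hx0.le, show 1 / c * (c - 1) = (c - 1) / c by field_simp,
      div_rpow hd0.le hN0.le, div_eq_mul_inv, ← rpow_neg hN0.le, show -((c - 1) / c) = (1 - c) / c by ring,
      mul_comm]

/-- **Baspin–Guruswami–Krishna–Li, Lemma 3.6 (as printed: a constant depending only on the separator
parameters).** For `β = C`, `c ∈ (0,1)` and the balance `p/q < 1` of the separators there is `α` such
that every `[[n,k,d]]` stabilizer code (`d ≥ 1`) presented by generators whose connectivity graph is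
`(s, p/q)`-separable with `s(m) ≤ C·m^c` has a correctable set `A` with `|V ∖ A| ≤ α·n/d^{(1−c)/c}`
(«Let β ≥ 1 and c ∈ (0,1) be constants. There exists a constant α = α(β,c) > 0 such that the following
holds for all positive integers n ≥ d. Let G be a graph on n vertices where s_G(r) ≤ βr^c for all r.
There exists a d-correctable set A such that |V∖A| ≤ (αn)/(d^{(1−c)/c})»; `n ≥ d` is not needed).
[cite: BaspinEtAl2024, §3.2 Lemma 3.6 (arXiv:2307.03283 chunk p0009 L1–5)] -/
theorem BaspinEtAl2024_lemma36 (p q : ℕ) (hpq : p < q) (C c : ℝ) (hc0 : 0 < c) (hc1 : c < 1) :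
    ∃ α : ℝ, 0 < α ∧ ∀ {n : ℕ} {G : Type u} (g : G → SympVec n) {S : Submodule (ZMod 2) (SympVec n)}
      {k d : ℕ} {s : ℕ → ℕ}, IsAdditiveCode S k d → S = Submodule.span (ZMod 2) (Set.range g) →
      IsSeparableWith g p q s → (∀ m : ℕ, (s m : ℝ) ≤ C * (m : ℝ) ^ c) → 1 ≤ d →
      ∃ U : Finset (Fin n), IsCorrectableRegion S U ∧ (#Uᶜ : ℝ) ≤ α * n / (d : ℝ) ^ ((1 - c) / c) := by
  obtain ⟨hε0, -⟩ := two_rpow_one_sub_bounds hc0 hc1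
  have hq : (0 : ℝ) < q := by exact_mod_cast (show 0 < q by omega)
  have hθ0 : 0 ≤ (p : ℝ) / q := div_nonneg (Nat.cast_nonneg _) hq.le
  have hθ1 : ((p : ℝ) / q) ^ c < 1 := rpow_lt_one hθ0 ((div_lt_one hq).2 (by exact_mod_cast hpq)) hc0
  set C' : ℝ := max C 0 with hC'
  set C₁ : ℝ := C' / (1 - ((p : ℝ) / q) ^ c) with hC₁
  have hC₁0 : 0 ≤ C₁ := div_nonneg (le_max_right _ _) (by linarith)
  have hK0 : 0 ≤ C₁ / (1 - (2 : ℝ) ^ (-c)) :=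
    div_nonneg hC₁0 (sub_pos.2 (rpow_lt_one_of_one_lt_of_neg one_lt_two (neg_lt_zero.2 hc0))).le
  set K : ℝ := C₁ / (1 - (2 : ℝ) ^ (-c)) with hK
  set a : ℝ := 8 * C₁ / ((2 : ℝ) ^ (1 - c) - 1) with ha
  set N : ℝ := 4 * (6 * C₁ + K) + 4 with hN
  have ha0 : 0 ≤ a := div_nonneg (by linarith) hε0.le
  have hN0 : 0 < N := by rw [hN]; nlinarith
  set d₀ : ℝ := N * (a + 1) ^ (c / (1 - c)) with hd₀
  set α₀ : ℝ := max (a * N ^ ((1 - c) / c)) (d₀ ^ ((1 - c) / c)) with hα₀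
  have hα₀ : 0 ≤ α₀ := (rpow_nonneg (mul_nonneg hN0.le (rpow_nonneg (by linarith) _)) _).trans (le_max_right _ _)
  refine ⟨α₀ + 1, by linarith, ?_⟩
  intro n G g S k d s hcode hS hsep hsC hd
  have hsC' : ∀ m : ℕ, (s m : ℝ) ≤ C' * (m : ℝ) ^ c := fun m =>
    (hsC m).trans (mul_le_mul_of_nonneg_right (le_max_left _ _) (rpow_nonneg (Nat.cast_nonneg _) _))
  have hd0 : (0 : ℝ) < d := by exact_mod_cast hd
  have hdc : 0 < (d : ℝ) ^ ((1 - c) / c) := rpow_pos_of_pos hd0 _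
  have hn : (0 : ℝ) ≤ n := Nat.cast_nonneg _
  have hαα : α₀ * n / (d : ℝ) ^ ((1 - c) / c) ≤ (α₀ + 1) * n / (d : ℝ) ^ ((1 - c) / c) :=
    div_le_div_of_nonneg_right (mul_le_mul_of_nonneg_right (by linarith) hn) hdc.le
  by_cases hdd₀ : d₀ ≤ d
  · obtain ⟨ρ, hρ, hρa, hρd, hρeq⟩ := exists_division_radius hC₁0 hc0 hc1 hdd₀
    obtain ⟨U, hU, hUc⟩ := BaspinEtAl2024_lemma36_radius g hcode hS hsep hpq hsC' hc0 hc1 hρ hρa hρd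
    refine ⟨U, hU, hUc.trans (le_trans ?_ hαα)⟩
    have h1 : (d : ℝ) ^ ((c - 1) / c) = ((d : ℝ) ^ ((1 - c) / c))⁻¹ := by
      rw [← rpow_neg hd0.le]; congr 1; ring
    rw [hρeq, h1]
    calc a * n * (N ^ ((1 - c) / c) * ((d : ℝ) ^ ((1 - c) / c))⁻¹)
        = a * N ^ ((1 - c) / c) * n / (d : ℝ) ^ ((1 - c) / c) := by ring
      _ ≤ α₀ * n / (d : ℝ) ^ ((1 - c) / c) :=
        div_le_div_of_nonneg_right (mul_le_mul_of_nonneg_right (le_max_left _ _) hn) hdc.le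
  · -- small distance: the constant absorbs it (U = ∅)
    refine ⟨∅, IsCorrectableRegion.of_card_lt hcode.2.2.1 (by rw [card_empty]; omega), le_trans ?_ hαα⟩
    rw [compl_empty, card_univ, Fintype.card_fin]
    have hlt : (d : ℝ) < d₀ := not_le.1 hdd₀
    have h1 : (d : ℝ) ^ ((1 - c) / c) ≤ d₀ ^ ((1 - c) / c) :=
      rpow_le_rpow hd0.le hlt.le (div_nonneg (by linarith) hc0.le)
    have h2 : (d : ℝ) ^ ((1 - c) / c) ≤ α₀ := h1.trans (le_max_right _ _)
    rw [le_div_iff₀ hdc]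
    exact mul_le_mul_of_nonneg_left h2 hn |>.trans_eq (mul_comm _ _)

/-- **Baspin–Guruswami–Krishna–Li, Theorem «thm:main» (formal version), as printed.** For `β = C`,
`c ∈ (0,1)` and the separator balance `p/q < 1` (the paper: `2/3`, Definition 2.8) there is a constant
`α = α(β,c,p/q)` such that for every `[[n,k,d]]` stabilizer code presented by generators whose connectivity
graph is `(s, p/q)`-separable with `s(m) ≤ C·m^c` for all `m`: `k·d^{(1−c²)/c} ≤ α·n`
(«Let β ≥ 1 and c ∈ (0,1) be constants. There exists a constant α = α(β,c) > 0 such that the following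
holds for all positive integers n, k, d. Let 𝒬 be a ⟦n,k,d⟧ quantum code with connectivity graph G. If the
separation profile of G satisfies s_G(r) ≤ βr^c …, then kd^{(1−c²)/c} ≤ αn»). Stabilizer codes; no
degree / LDPC hypothesis; `c = 1` is the trivial `k ≤ n`. Proof as printed (Lemma 3.4 = Lemma 3.6 + the
Baspin–Krishna recursion, then `k ≤ |C|`), with the r-division replaced as described in the module
docstring. [cite: BaspinEtAl2024, §3.2 Theorem «thm:main» formal (arXiv:2307.03283 chunk p0007 L98 – p0008 L1), Lemma 3.4 and its proof (chunk p0008 L3–8, p0009 L50–68); §1 informal statement (chunk p0004 L15–24)] -/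
theorem BaspinEtAl2024_theorem_main (p q : ℕ) (hpq : p < q) (C c : ℝ) (hc0 : 0 < c) (hc1 : c ≤ 1) :
    ∃ α : ℝ, 0 < α ∧ ∀ {n : ℕ} {G : Type u} (g : G → SympVec n) {S : Submodule (ZMod 2) (SympVec n)}
      {k d : ℕ} {s : ℕ → ℕ}, IsAdditiveCode S k d → S = Submodule.span (ZMod 2) (Set.range g) →
      IsSeparableWith g p q s → (∀ m : ℕ, (s m : ℝ) ≤ C * (m : ℝ) ^ c) →
      (k : ℝ) * (d : ℝ) ^ ((1 - c ^ 2) / c) ≤ α * n := by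
  rcases hc1.eq_or_lt with rfl | hc1
  · -- c = 1: the exponent vanishes and k ≤ n
    refine ⟨1, one_pos, ?_⟩
    intro n G g S k d s hcode _ _ _
    have hkn : k ≤ n := by have := hcode.2.1; omega
    rw [show ((1 : ℝ) - 1 ^ 2) / 1 = 0 by norm_num, rpow_zero, mul_one, one_mul]
    exact_mod_cast hkn
  obtain ⟨hε0, -⟩ := two_rpow_one_sub_bounds hc0 hc1
  have hq : (0 : ℝ) < q := by exact_mod_cast (show 0 < q by omega)
  have hθ0 : 0 ≤ (p : ℝ) / q := div_nonneg (Nat.cast_nonneg _) hq.le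
  have hθ1 : ((p : ℝ) / q) ^ c < 1 := rpow_lt_one hθ0 ((div_lt_one hq).2 (by exact_mod_cast hpq)) hc0
  set C' : ℝ := max C 0 with hC'
  set C₁ : ℝ := C' / (1 - ((p : ℝ) / q) ^ c) with hC₁
  have hC₁0 : 0 ≤ C₁ := div_nonneg (le_max_right _ _) (by linarith)
  have hK0 : 0 ≤ C₁ / (1 - (2 : ℝ) ^ (-c)) :=
    div_nonneg hC₁0 (sub_pos.2 (rpow_lt_one_of_one_lt_of_neg one_lt_two (neg_lt_zero.2 hc0))).le
  set K : ℝ := C₁ / (1 - (2 : ℝ) ^ (-c)) with hK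
  set a : ℝ := 8 * C₁ / ((2 : ℝ) ^ (1 - c) - 1) with ha
  set N : ℝ := 4 * (6 * C₁ + K) + 4 with hN
  set M : ℝ := C₁ * (2 : ℝ) ^ (1 - c) / ((2 : ℝ) ^ (1 - c) - 1) with hM
  have ha0 : 0 ≤ a := div_nonneg (by linarith) hε0.le
  have hN0 : 0 < N := by rw [hN]; nlinarith
  have hM0 : 0 ≤ M := div_nonneg (mul_nonneg hC₁0 (rpow_nonneg zero_le_two _)) hε0.le
  set d₀ : ℝ := N * (a + 1) ^ (c / (1 - c)) with hd₀
  have hd₀0 : 0 ≤ d₀ := mul_nonneg hN0.le (rpow_nonneg (by linarith) _)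
  have hE0 : 0 < (1 - c ^ 2) / c := div_pos (by nlinarith) hc0
  have hα1 : 0 ≤ M * a * N ^ ((1 - c) / c) := mul_nonneg (mul_nonneg hM0 ha0) (rpow_nonneg hN0.le _)
  have hα2 : 0 ≤ d₀ ^ ((1 - c ^ 2) / c) := rpow_nonneg hd₀0 _
  refine ⟨M * a * N ^ ((1 - c) / c) + d₀ ^ ((1 - c ^ 2) / c) + 1, by linarith, ?_⟩
  intro n G g S k d s hcode hS hsep hsC
  have hsC' : ∀ m : ℕ, (s m : ℝ) ≤ C' * (m : ℝ) ^ c := fun m =>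
    (hsC m).trans (mul_le_mul_of_nonneg_right (le_max_left _ _) (rpow_nonneg (Nat.cast_nonneg _) _))
  have hn : (0 : ℝ) ≤ n := Nat.cast_nonneg _
  have hkn : (k : ℝ) ≤ n := by have := hcode.2.1; exact_mod_cast (by omega : k ≤ n)
  rcases Nat.eq_zero_or_pos d with hd | hd
  · -- d = 0: the left-hand side vanishes
    subst hd
    rw [Nat.cast_zero, zero_rpow hE0.ne', mul_zero]
    exact mul_nonneg (by linarith) hn
  have hd0 : (0 : ℝ) < d := by exact_mod_cast hd
  have hdE : 0 < (d : ℝ) ^ ((1 - c ^ 2) / c) := rpow_pos_of_pos hd0 _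
  by_cases hdd₀ : d₀ ≤ d
  · obtain ⟨ρ, hρ, hρa, hρd, hρeq⟩ := exists_division_radius hC₁0 hc0 hc1 hdd₀
    have hk := BaspinEtAl2024_lemma34_radius g hcode hS hsep hpq hsC' hc0 hc1 hd hρ hρa hρd
    rw [hρeq] at hk
    have hexp : (d : ℝ) ^ ((c - 1) / c) * (d : ℝ) ^ (c - 1) * (d : ℝ) ^ ((1 - c ^ 2) / c) = 1 := by
      rw [← rpow_add hd0, ← rpow_add hd0, show (c - 1) / c + (c - 1) + (1 - c ^ 2) / c = 0 by
        field_simp; ring, rpow_zero]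
    have hk' := mul_le_mul_of_nonneg_right hk hdE.le
    calc (k : ℝ) * (d : ℝ) ^ ((1 - c ^ 2) / c)
        ≤ M * (a * n * (N ^ ((1 - c) / c) * (d : ℝ) ^ ((c - 1) / c))) * (d : ℝ) ^ (c - 1) *
            (d : ℝ) ^ ((1 - c ^ 2) / c) := hk'
      _ = M * a * N ^ ((1 - c) / c) * n *
            ((d : ℝ) ^ ((c - 1) / c) * (d : ℝ) ^ (c - 1) * (d : ℝ) ^ ((1 - c ^ 2) / c)) := by ring
      _ = M * a * N ^ ((1 - c) / c) * n := by rw [hexp, mul_one]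
      _ ≤ (M * a * N ^ ((1 - c) / c) + d₀ ^ ((1 - c ^ 2) / c) + 1) * n := by nlinarith
  · -- small distance: k ≤ n and d^E ≤ d₀^E
    have hlt : (d : ℝ) < d₀ := not_le.1 hdd₀
    have h1 : (d : ℝ) ^ ((1 - c ^ 2) / c) ≤ d₀ ^ ((1 - c ^ 2) / c) := rpow_le_rpow hd0.le hlt.le hE0.le
    calc (k : ℝ) * (d : ℝ) ^ ((1 - c ^ 2) / c) ≤ n * d₀ ^ ((1 - c ^ 2) / c) :=
          mul_le_mul hkn h1 hdE.le hn
      _ ≤ (M * a * N ^ ((1 - c) / c) + d₀ ^ ((1 - c ^ 2) / c) + 1) * n := by nlinarith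

end Real

end Literature.InformationTheory.QuantumCodes
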